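import Summits.CriticalPhenomena.PercolationContinuityZ3.Theorems.Transplant.PlanarSkeletonFrmQuasiDefs
import Summits.CriticalPhenomena.PercolationContinuityZ3.Theorems.Transplant.SkelFrmQuasiBChoiceResidC
import Summits.CriticalPhenomena.PercolationContinuityZ3.Theorems.Transplant.SkelFrmBChoiceResidC
import Summits.CriticalPhenomena.PercolationContinuityZ3.Theorems.Transplant.SkelFrmQuasiBChoiceResidF2
import Summits.CriticalPhenomena.PercolationContinuityZ3.Theorems.Transplant.SkelFrmBChoiceResidF2
import Summits.CriticalPhenomena.PercolationContinuityZ3.Theorems.Transplant.SkelFrmQuasiBChoiceDepthYW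
import Summits.CriticalPhenomena.PercolationContinuityZ3.Theorems.Transplant.SkelFrmBChoiceDepthYW
import Summits.CriticalPhenomena.PercolationContinuityZ3.Theorems.Transplant.SkelFrmQuasiBChoiceDepth2
import Summits.CriticalPhenomena.PercolationContinuityZ3.Theorems.Transplant.SkelFrmBChoiceDepth2
import Summits.CriticalPhenomena.PercolationContinuityZ3.Theorems.Transplant.SkelFrmQuasiBParamsBridge0
import Summits.CriticalPhenomena.PercolationContinuityZ3.Theorems.Transplant.SkelFrmBParamsBridge0
import Summits.CriticalPhenomena.PercolationContinuityZ3.Theorems.Transplant.SkelFrmQuasiBParamsBridgeF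
import Summits.CriticalPhenomena.PercolationContinuityZ3.Theorems.Transplant.SkelFrmBParamsBridgeF
import Summits.CriticalPhenomena.PercolationContinuityZ3.Theorems.Transplant.SkelFrmQuasi1ChoiceDefs
import Summits.CriticalPhenomena.PercolationContinuityZ3.Theorems.Transplant.SkelFrmQuasi1SlotTypes
import Summits.CriticalPhenomena.PercolationContinuityZ3.Theorems.Transplant.SkelFrmQuasiBChoiceNums
import Summits.CriticalPhenomena.PercolationContinuityZ3.Theorems.Transplant.SkelFrmQuasiBChoiceResidF
import Summits.CriticalPhenomena.PercolationContinuityZ3.Theorems.Transplant.SkelFrmQuasiBParamsCorrKG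
import Summits.CriticalPhenomena.PercolationContinuityZ3.Theorems.Transplant.SkelFrmQuasiBParamsCorrKGLen3
import Summits.CriticalPhenomena.PercolationContinuityZ3.Theorems.Transplant.SkelFrmQuasiBParamsLF
import Summits.CriticalPhenomena.PercolationContinuityZ3.Theorems.Transplant.SkelFrmQuasiBParamsSlots
import Summits.CriticalPhenomena.PercolationContinuityZ3.Theorems.Transplant.SkelFrmQuasiBParamsSlotsS
import Summits.CriticalPhenomena.PercolationContinuityZ3.Theorems.Transplant.SkelFrmQuasiBParamsSlotsT
import Summits.CriticalPhenomena.PercolationContinuityZ3.Theorems.Transplant.SkelFrmQuasi1SlotTypes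
import HarnessLib
import Summits.CriticalPhenomena.PercolationContinuityZ3.Theorems.Transplant.SkelFrmBChoiceResidQV
/-!
# GEN-Q PORT (WAVE-Q table v0.8 section 2, row G220, U-level L23; captain R-6/R-7 2026-08-27: carrier token swap `PlanarSkeletonFrmFrom ↦ PlanarSkeletonFrmQuasi`)
# of the tree module «Transplant/SkelFrmFromBChoiceResidQV» (sha256 fe606368567e3291…) onto the quasi-step carrier `PlanarSkeletonFrmQuasi` (p507026): «SkelFrmQuasiBChoiceResidQV»

ORIGINAL TITLE: N2 (frames-only node `SamePDropOfSkeletonFrm₁`, OPEN) — (ζ″) under (R-44)/(R-47): THE NODE TUPLE's RESIDUAL UNIONS `gxQ/fxQ/exQ/mxQ/PxQ` AT THE WIDER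

builds on p205010 (kernel theorem, internal audit signed; external expert review pending) — nothing in this file uses p205010; NOTHING is claimed about any open node
((N3-b), the end state).  Lane `prim-bschramm`, seat `prim-bschramm-p3` (gen 30; design owner; tool = captain gen-1 g4's port_genq.py R-14 --cone + p3-g30 slot-value patch T1).  Helper file (`--supports stmt-CriticalPhenomena-4575 --as helper`).
PORT RULES (U-wave r1–r4 re-used, GEN-Q hunk classes of p3-g29 #6136): declaration order, names and proof texts are those of «SkelFrmFromBChoiceResidQV», byte-identical except
(i) the carrier token `PlanarSkeletonFrmFrom ↦ PlanarSkeletonFrmQuasi` in binders, `namespace`/`end` lines and qualified names (module names `SkelFrmFrom… ↦ SkelFrmQuasi…`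
in imports of already-ported rows); (ii) `Φ.step ↦ Φ.qstep` with the called Steps lemma replaced by its `…Q`/`_q` twin and the cost `Φ.M` threaded (none in this file unless
listed below); (iii) `Φ.cyl_connected ↦ Φ.cyl_reach` readers (none unless listed); (iv) graph-ball radii / window floors ×`Φ.M` (none unless listed); (v) L-KitS-1 (design-owner ruling 2026-08-27): the (S0) kit data of «SkelFrmQuasiBChoiceNums» (stmt-g33, G017) are
N-parametrised — IN THIS FILE the readers `KS0.R'0/r₀0/r₀0_ge/base0/reach0 ↦ …N` resp. `KS.RA' ↦ KS.RAN'`, instantiated at `N := KS.NQ Φ = 13·max Φ.M 1`, nothing else.  Carrier-free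
residents stay imported/exported from the original «SkelFrmBChoiceResidQV» exactly as in the FrmFrom port.  Docstrings and citations are the original's.

-/

open scoped Classical

noncomputable section

namespace Summit.CriticalPhenomena.PercolationContinuityZ3.Theorems.Transplant

namespace PlanarSkeletonFrmQuasi

namespace NegB

open Literature.Probability.Percolation Literature.Probability.LatticeModels SimpleGraph
open SkelConc (Consts)
open Skelφ.StepI (DataNS OutNS)
open Neg

export PlanarSkeletonFrm.NegB (cF)

export PlanarSkeletonFrm.NegB (cF_eq)

section Unions

variable (mk : ℕ) (gxR fxR : Neg.FSlot) (exR mxR : GSlot) (PxR : PSlot)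

/-- **The node's width residual** `fxQ := fxC ⊔ fxFc ⊔ fxR`. [this work] -/
def fxQ : Neg.FSlot := fun κ _ _ _ _ _ Φ t p D => max (fxC mk κ Φ t p D) (max (fxFc mk κ Φ t p D) (fxR κ Φ t p D))

/-- **The node's box residual** `gxQ := gxC ⊔ gxFc (cF κ) ⊔ gxR ⊔ (2·fT + 5·R′0 + 3)` — the last member READS THE WIDTH SLOT VALUE `KS.fT mk (fxQ …)`
((R-47)(b) as amended by p3-g17 13:12:37Z/13:34:28Z: the second-axis cross link at the prefix's minimal window needs `2f + 5R′0 + 2 ≤ g − 1`;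
lead g12 12:52:21Z: slot order `f` before `g`). [this work] -/
def gxQ : Neg.FSlot := fun κ _ _ _ _ _ Φ t p D =>
  max (gxC mk κ Φ t p D) (max (gxFc mk (cF κ) κ Φ t p D) (max (gxR κ Φ t p D) (2 * KS.fT mk (fxQ mk fxR) κ Φ t p D + 5 * KS0.R'0N κ Φ (KS.NQ Φ) t p D mk + 3)))

/-- **The node's excess residual** `exQ := exC ⊔ (ZD2 + 4) ⊔ (ZDYW + 4) ⊔ exFc (cF κ) ⊔ exF2 (cF κ) ⊔ exR` (the two depth floors at the wider windows; `exF2` =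
hp-8's (F)-wrapper residual, SkelFrmBChoiceResidF2). [this work] -/
def exQ : GSlot := fun κ _ _ _ _ _ Φ t p D g f =>
  max (exC mk κ Φ t p D g f) (max (ZD2 κ Φ t p D g f + 4) (max (ZDYW κ Φ t p D g f + 4) (max (exFc mk (cF κ) κ Φ t p D g f) (max (exF2 mk (cF κ) κ Φ t p D g f) (exR κ Φ t p D g f)))))

/-- **The node's rim-diameter residual** `mxQ := mxR` (the (C) floor is built into `mRS`; the slot only forwards the (R)/(F) demand). [this work] -/
def mxQ : GSlot := fun κ _ _ _ _ _ Φ t p D g f => mxR κ Φ t p D g f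

/-- **The node's extra-pair slot** `PxQ := Px0 ∪ PxF (cF κ) ∪ PxR` (admissibility inherited from the three members). [this work] -/
def PxQ : PSlot := fun κ _ _ _ _ _ Φ t p D =>
  ⟨(KS.Px0 mk κ Φ t p D).1 ∪ ((KS.PxF (cF κ) mk κ Φ t p D).1 ∪ (PxR κ Φ t p D).1), fun q hq => by
    rcases Finset.mem_union.1 hq with h | h
    · exact (KS.Px0 mk κ Φ t p D).2 q h
    · rcases Finset.mem_union.1 h with h' | h'
      · exact (KS.PxF (cF κ) mk κ Φ t p D).2 q h'
      · exact (PxR κ Φ t p D).2 q h'⟩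

variable (κ : Consts) {V : Type} [DecidableEq V] [Countable V] {G : SimpleGraph V} [G.LocallyFinite] (Φ : PlanarSkeletonFrmQuasi G) (t : V) (p : unitInterval)
  (D : DataNS V) (g f : ℕ)

/-- The four box-residual dominations (the last: `2·fT + 5·R′0 + 3 ≤ gxQ`). [folklore] -/
theorem le_gxQ (κ : Consts) {V : Type} [DecidableEq V] [Countable V] {G : SimpleGraph V} [G.LocallyFinite] (Φ : PlanarSkeletonFrmQuasi G) (t : V) (p : unitInterval) (D : DataNS V) : gxC mk κ Φ t p D ≤ gxQ mk gxR fxR κ Φ t p D ∧ gxFc mk (cF κ) κ Φ t p D ≤ gxQ mk gxR fxR κ Φ t p D ∧ gxR κ Φ t p D ≤ gxQ mk gxR fxR κ Φ t p D ∧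
    2 * KS.fT mk (fxQ mk fxR) κ Φ t p D + 5 * KS0.R'0N κ Φ (KS.NQ Φ) t p D mk + 3 ≤ gxQ mk gxR fxR κ Φ t p D :=
  ⟨le_max_left _ _, (le_max_left _ _).trans (le_max_right _ _), ((le_max_left _ _).trans (le_max_right _ _)).trans (le_max_right _ _),
    ((le_max_right _ _).trans (le_max_right _ _)).trans (le_max_right _ _)⟩

/-- **THE (R-47)(b) CROSS-COLUMN ROW at the composed slots** (p3-g17's `hfg`): `2·fT + 5·R′0 + 3 ≤ KS.gT mk (gxQ …)`. [this work] -/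
theorem two_fT_le_gT (κ : Consts) {V : Type} [DecidableEq V] [Countable V] {G : SimpleGraph V} [G.LocallyFinite] (Φ : PlanarSkeletonFrmQuasi G) (t : V) (p : unitInterval) (D : DataNS V) : 2 * KS.fT mk (fxQ mk fxR) κ Φ t p D + 5 * KS0.R'0N κ Φ (KS.NQ Φ) t p D mk + 3 ≤ KS.gT mk (gxQ mk gxR fxR) κ Φ t p D :=
  (le_gxQ mk gxR fxR κ Φ t p D).2.2.2.trans (KS.gT_floors κ Φ t p D mk (gxQ mk gxR fxR)).2.2.2

/-- The three width-residual dominations. [folklore] -/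
theorem le_fxQ (κ : Consts) {V : Type} [DecidableEq V] [Countable V] {G : SimpleGraph V} [G.LocallyFinite] (Φ : PlanarSkeletonFrmQuasi G) (t : V) (p : unitInterval) (D : DataNS V) : fxC mk κ Φ t p D ≤ fxQ mk fxR κ Φ t p D ∧ fxFc mk κ Φ t p D ≤ fxQ mk fxR κ Φ t p D ∧ fxR κ Φ t p D ≤ fxQ mk fxR κ Φ t p D :=
  ⟨le_max_left _ _, (le_max_left _ _).trans (le_max_right _ _), (le_max_right _ _).trans (le_max_right _ _)⟩

/-- The five excess-residual dominations. [folklore] -/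
theorem le_exQ (κ : Consts) {V : Type} [DecidableEq V] [Countable V] {G : SimpleGraph V} [G.LocallyFinite] (Φ : PlanarSkeletonFrmQuasi G) (t : V) (p : unitInterval) (D : DataNS V) (g : ℕ) (f : ℕ) : exC mk κ Φ t p D g f ≤ exQ mk exR κ Φ t p D g f ∧ ZD2 κ Φ t p D g f + 4 ≤ exQ mk exR κ Φ t p D g f ∧
    ZDYW κ Φ t p D g f + 4 ≤ exQ mk exR κ Φ t p D g f ∧ exFc mk (cF κ) κ Φ t p D g f ≤ exQ mk exR κ Φ t p D g f ∧ exR κ Φ t p D g f ≤ exQ mk exR κ Φ t p D g f := by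
  unfold exQ
  refine ⟨le_max_left _ _, ?_, ?_, ?_, ?_⟩
  · exact (le_max_left _ _).trans (le_max_right _ _)
  · exact ((le_max_left _ _).trans (le_max_right _ _)).trans (le_max_right _ _)
  · exact (((le_max_left _ _).trans (le_max_right _ _)).trans (le_max_right _ _)).trans (le_max_right _ _)
  · exact ((((le_max_right _ _).trans (le_max_right _ _)).trans (le_max_right _ _)).trans (le_max_right _ _)).trans (le_max_right _ _)

/-- **hp-8's wrapper residual inside `exQ`**: `exF2 mk (cF κ) ≤ exQ` (the (F) node file's hypothesis (3) verbatim; `exF2` = SkelFrmBChoiceResidF2). [folklore] -/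
theorem exF2_le_exQ (κ : Consts) {V : Type} [DecidableEq V] [Countable V] {G : SimpleGraph V} [G.LocallyFinite] (Φ : PlanarSkeletonFrmQuasi G) (t : V) (p : unitInterval) (D : DataNS V) (g : ℕ) (f : ℕ) : exF2 mk (cF κ) κ Φ t p D g f ≤ exQ mk exR κ Φ t p D g f := by
  unfold exQ
  exact ((((le_max_left _ _).trans (le_max_right _ _)).trans (le_max_right _ _)).trans (le_max_right _ _)).trans (le_max_right _ _)

-- GEN-Q (R-2, captain 2026-08-27): `PlanarSkeletonFrmFrom.NegB.mxQ_at` is not in the used cone of the node top — not ported.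

/-- The three pair-slot inclusions. [folklore] -/
theorem subset_PxQ (κ : Consts) {V : Type} [DecidableEq V] [Countable V] {G : SimpleGraph V} [G.LocallyFinite] (Φ : PlanarSkeletonFrmQuasi G) (t : V) (p : unitInterval) (D : DataNS V) : (KS.Px0 mk κ Φ t p D).1 ⊆ (PxQ mk PxR κ Φ t p D).1 ∧ (KS.PxF (cF κ) mk κ Φ t p D).1 ⊆ (PxQ mk PxR κ Φ t p D).1 ∧
    (PxR κ Φ t p D).1 ⊆ (PxQ mk PxR κ Φ t p D).1 :=
  ⟨Finset.subset_union_left, Finset.subset_union_left.trans Finset.subset_union_right, Finset.subset_union_right.trans Finset.subset_union_right⟩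

end Unions

/-! ## The dominations at the composed slots `KS.gT mk (gxQ …)` / `KS.fT mk (fxQ …)` (the `_of_le` wrappers' hypotheses, verbatim) -/

section AtSlots

variable (mk : ℕ) (gxR fxR : Neg.FSlot) (κ : Consts) {V : Type} [DecidableEq V] [Countable V] {G : SimpleGraph V} [G.LocallyFinite] (Φ : PlanarSkeletonFrmQuasi G)
  (t : V) (p : unitInterval) (D : DataNS V)

/-- `gxC ≤ gT (gxQ)`, `gxFc (cF κ) ≤ gT (gxQ)`, `gxR ≤ gT (gxQ)` (`gxQ ≤ gT`, `KS.gT_floors`). [folklore] -/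
theorem le_gT_gxQ (mk : ℕ) (gxR : Neg.FSlot) (fxR : Neg.FSlot) (κ : Consts) {V : Type} [DecidableEq V] [Countable V] {G : SimpleGraph V} [G.LocallyFinite] (Φ : PlanarSkeletonFrmQuasi G) (t : V) (p : unitInterval) (D : DataNS V) : gxC mk κ Φ t p D ≤ KS.gT mk (gxQ mk gxR fxR) κ Φ t p D ∧ gxFc mk (cF κ) κ Φ t p D ≤ KS.gT mk (gxQ mk gxR fxR) κ Φ t p D ∧
    gxR κ Φ t p D ≤ KS.gT mk (gxQ mk gxR fxR) κ Φ t p D := by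
  have h := (KS.gT_floors κ Φ t p D mk (gxQ mk gxR fxR)).2.2.2
  obtain ⟨h1, h2, h3, -⟩ := le_gxQ mk gxR fxR κ Φ t p D
  exact ⟨h1.trans h, h2.trans h, h3.trans h⟩

/-- `fxC ≤ fT (fxQ)`, `fxFc ≤ fT (fxQ)`, `fxR ≤ fT (fxQ)` (`fxQ ≤ fT`, `KS.fT_floors`). [folklore] -/
theorem le_fT_fxQ (mk : ℕ) (fxR : Neg.FSlot) (κ : Consts) {V : Type} [DecidableEq V] [Countable V] {G : SimpleGraph V} [G.LocallyFinite] (Φ : PlanarSkeletonFrmQuasi G) (t : V) (p : unitInterval) (D : DataNS V) : fxC mk κ Φ t p D ≤ KS.fT mk (fxQ mk fxR) κ Φ t p D ∧ fxFc mk κ Φ t p D ≤ KS.fT mk (fxQ mk fxR) κ Φ t p D ∧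
    fxR κ Φ t p D ≤ KS.fT mk (fxQ mk fxR) κ Φ t p D := by
  have h := (KS.fT_floors κ Φ t p D mk (fxQ mk fxR)).2.2.2
  obtain ⟨h1, h2, h3⟩ := le_fxQ mk fxR κ Φ t p D
  exact ⟨h1.trans h, h2.trans h, h3.trans h⟩

/-- The three members are in the composed pair slot `KS.PR mk (PxQ …)` (`PR mk Px ⊇ Px`). [folklore] -/
theorem subset_PR_PxQ (mk : ℕ) (κ : Consts) {V : Type} [DecidableEq V] [Countable V] {G : SimpleGraph V} [G.LocallyFinite] (Φ : PlanarSkeletonFrmQuasi G) (t : V) (p : unitInterval) (D : DataNS V) (PxR : PSlot) : (KS.Px0 mk κ Φ t p D).1 ⊆ (KS.PR mk (PxQ mk PxR) κ Φ t p D).1 ∧ (KS.PxF (cF κ) mk κ Φ t p D).1 ⊆ (KS.PR mk (PxQ mk PxR) κ Φ t p D).1 ∧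
    (PxR κ Φ t p D).1 ⊆ (KS.PR mk (PxQ mk PxR) κ Φ t p D).1 := by
  obtain ⟨h1, h2, h3⟩ := subset_PxQ mk PxR κ Φ t p D
  have h : (PxQ mk PxR κ Φ t p D).1 ⊆ (KS.PR mk (PxQ mk PxR) κ Φ t p D).1 := fun q hq => Finset.mem_union_right _ hq
  exact ⟨h1.trans h, h2.trans h, h3.trans h⟩

end AtSlots

/-! ## The (C) floor families at the tuple (`HX_Q`/`HY_Q`'s `Hg`, `Hex`, `HexY`) -/

section Discharge

variable {κ : Consts} {V : Type} [DecidableEq V] [Countable V] {G : SimpleGraph V} [G.LocallyFinite] {Φ : PlanarSkeletonFrmQuasi G} {t : V} {p : unitInterval}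
  (mk : ℕ) (gxR fxR : Neg.FSlot) (exR : GSlot)

/-- **`Hg` at the tuple**: `gFloorKG ≤ KS.gT mk (gxQ …)` and `40·K·R′0 ≤ KS.gT mk (gxQ …)` (`gxC ≤ gxQ ≤ gT`). [folklore] -/
theorem Hg_Q {κ : Consts} {V : Type} [DecidableEq V] [Countable V] {G : SimpleGraph V} [G.LocallyFinite] {Φ : PlanarSkeletonFrmQuasi G} {t : V} {p : unitInterval} (mk : ℕ) (gxR : Neg.FSlot) (fxR : Neg.FSlot) (D : DataNS V) :
    gFloorKG κ Φ t p D mk ≤ KS.gT mk (gxQ mk gxR fxR) κ Φ t p D ∧ 40 * Neg.K κ * KS0.R'0N κ Φ (KS.NQ Φ) t p D mk ≤ KS.gT mk (gxQ mk gxR fxR) κ Φ t p D :=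
  Hg_of_ge (fun D => ((le_gxQ mk gxR fxR κ Φ t p D).1).trans (KS.gT_floors κ Φ t p D mk (gxQ mk gxR fxR)).2.2.2) D

-- GEN-Q (R-2, captain 2026-08-27): `PlanarSkeletonFrmFrom.NegB.Hex_Q` is not in the used cone of the node top — not ported.

-- GEN-Q (R-2, captain 2026-08-27): `PlanarSkeletonFrmFrom.NegB.HexY_Q` is not in the used cone of the node top — not ported.

-- GEN-Q (R-2, captain 2026-08-27): `PlanarSkeletonFrmFrom.NegB.πBud_le_Lp_Q` is not in the used cone of the node top — not ported.

-- GEN-Q (R-2, captain 2026-08-27): `PlanarSkeletonFrmFrom.NegB.exQ_le_Lp` is not in the used cone of the node top — not ported.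

end Discharge

end NegB

end PlanarSkeletonFrmQuasi

end Summit.CriticalPhenomena.PercolationContinuityZ3.Theorems.Transplant

end
-- build-touch 2026-08-25T07:00:05Z T1-A (lead g18): re-land of p389070, declarations byte-identical
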